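import Summits.KontsevichZagierPeriods.Zeta5Search.Certificates.RecordRayDenominatorsSize
import Summits.KontsevichZagierPeriods.Zeta5Search.ConstantTermFloorWindow
import Summits.KontsevichZagierPeriods.Zeta5Search.ValuationLawsWindow
import Summits.KontsevichZagierPeriods.Zeta5Search.ClusterValuationPairs
import Literature.NumberTheory.Irrationality.Hata1992.PrimeWindows
import Literature.NumberTheory.Transcendental.ZudilinLemma19
import HarnessLib

/-!
# ζ(5) search — the record ray's DENOMINATORS, III: per-prime valuations on the four big-prime windows (TYPER g15)

HONEST FRAMING: systematic search; no irrationality claim unless certified.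

OUR work (Summit side; typer seat, generation 15).  Sequel of `RecordRayDenominators{,Size}`.  The baseline multiplier
`M0 n = d_{41n}⁹·N♯(b)N♯(b′)/|ρ(a·n)|` carries nine powers of every prime `p ≤ 41n`; for the primes `16n < p ≤ 41n` the
tree PROVES, prime by prime, lower bounds for the valuations of the three coefficients at `b = bRecord n` and at the
partner `b′ = b + e₇` (`coeff_bounds_bRecord`, `coeff_bounds_bRecord'`):

* THEOREM V (`ClusterValuation.constantTermFloorLaw_window`, typer g9): `v_p(V) ≥ −N_p`, and on the ray
  `N_p(b), N_p(b′) ≤ [p ≤ 17n] + [p ≤ 18n]` (`pairFloors_bRecord_le`, `pairFloors_bRecord'_le`: the 21 pair blocks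
  `(7+i+k)n ≤ 18n` hold at most one multiple of `p`, and only the blocks `17n, 18n` can);
* the big-prime window (`BigPrime.one_le_padicValRat_coeffW_of_slots`, `padicNorm_coeff_le_one_of_slots`, typer g7):
  `v_p(W) ≥ 1` for `16n < p ≤ 25n`, and `W, U` are `p`-integral for `p > 16n` (slots `b₇ ≤ b₆ ≤ b₅ ≤ …`);
* bookkeeping: `v_p(d_{41n}) = 1` (`padicValRat_dRec`), `v_p(N♯) ≥ 0` for `p > 16n` (`padicValRat_sharpNormaliser_nonneg`),
  `bRecord n = bRec n` (the ray of the class-bound files) and `b, b′` in the polytope.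

File IV (`RecordRayDenominatorsExponent`) turns these into the divisibility of the multiplied wedge by
`∏_{16n<p≤17n} p⁸ ∏_{17n<p≤18n} p⁹ ∏_{18n<p≤25n} p¹⁰ ∏_{25n<p≤41n} p⁹` and the hypothesis-free exponent `0.4949`.
-/

noncomputable section

open Finset Real Filter Topology

namespace Summit.KontsevichZagierPeriods.Zeta5Search.RecordRay

open Summit.KontsevichZagierPeriods.Zeta5Search.DualSeries
open Summit.KontsevichZagierPeriods.Zeta5Search.DualSeriesDenominators
open Summit.KontsevichZagierPeriods.Zeta5Search.WedgeDictionary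
open Summit.KontsevichZagierPeriods.Zeta5Search.DualSeriesLemma19 (bRecord)
open Summit.KontsevichZagierPeriods.Zeta5Search.CasoratianValuation (InPolytope pairFloors shift)
open Summit.KontsevichZagierPeriods.Zeta5Search.ClusterValuation (bRec inPolytope_bRec inPolytope_shift_bRec
  constantTermFloorLaw_window)
open Summit.KontsevichZagierPeriods.Zeta5Search.BigPrime (record_ray_prime_dvd_coeffW one_le_padicValRat_coeffW_of_slots
  padicNorm_coeff_le_one_of_slots padicValRat_nonneg_of_padicNorm_le_one)
open Literature.NumberTheory.Irrationality.Hata1992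
open Literature.NumberTheory.Transcendental (zetaValue)

/-! ### The ray and its partner in the polytope -/

/-- `bRecord n` is the record ray `bRec n` of the class-bound files. -/
theorem bRecord_eq_bRec (n : ℕ) : bRecord n = bRec n := by
  funext j
  rcases Nat.lt_or_ge j 8 with h | h
  · interval_cases j
    · rw [bRecord_zero]; simp [bRec]; ring
    all_goals rw [bRecord_slot n (by norm_num) (by norm_num)]; simp [bRec]; ring
  · have h1 : j ≠ 0 := by omega
    have h2 : ¬ j ≤ 7 := by omega
    simp [bRecord, bRec, h1, h2, List.getD_eq_getElem?_getD, List.getElem?_eq_none (by simp; omega : ([41, 17, 16, 15, 14, 13, 12, 11] : List ℤ).length ≤ j)]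

/-- The partner is the contiguous shift: `bRecord' n = shift (bRecord n) 7`. -/
theorem bRecord'_eq_shift (n : ℕ) : bRecord' n = shift (bRecord n) 7 := rfl

/-- The ray lies in the polytope. -/
theorem inPolytope_bRecord (n : ℕ) : InPolytope (bRecord n) := by
  rw [bRecord_eq_bRec]; exact inPolytope_bRec n

/-- The partner lies in the polytope (`n ≥ 1`). -/
theorem inPolytope_bRecord' {n : ℕ} (hn : 1 ≤ n) : InPolytope (bRecord' n) := by
  rw [bRecord'_eq_shift, bRecord_eq_bRec]; exact inPolytope_shift_bRec n 7 hn (by norm_num) le_rfl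

/-- The values of `bRecord n` (as integers). -/
theorem bRecord_vals (n : ℕ) : bRecord n 0 = 41 * n ∧ bRecord n 1 = 17 * n ∧ bRecord n 2 = 16 * n ∧ bRecord n 3 = 15 * n ∧
    bRecord n 4 = 14 * n ∧ bRecord n 5 = 13 * n ∧ bRecord n 6 = 12 * n ∧ bRecord n 7 = 11 * n := by
  refine ⟨by rw [bRecord_zero], ?_, ?_, ?_, ?_, ?_, ?_, ?_⟩
  all_goals rw [bRecord_slot n (by norm_num) (by norm_num)]; push_cast; ring

/-- The values of `bRecord' n` (as integers). -/
theorem bRecord'_vals (n : ℕ) : bRecord' n 0 = 41 * n ∧ bRecord' n 1 = 17 * n ∧ bRecord' n 2 = 16 * n ∧ bRecord' n 3 = 15 * n ∧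
    bRecord' n 4 = 14 * n ∧ bRecord' n 5 = 13 * n ∧ bRecord' n 6 = 12 * n ∧ bRecord' n 7 = 11 * n + 1 := by
  refine ⟨by rw [bRecord'_zero], ?_, ?_, ?_, ?_, ?_, ?_, by rw [bRecord'_seven]⟩
  all_goals rw [bRecord'_slot n (by norm_num) (by norm_num)]; push_cast; ring

/-- `d(bRecord n) = 25n`. -/
theorem dOf_bRecord (n : ℕ) : dOf (bRecord n) = 25 * n := by
  rw [← bOfA_aRec]; exact dOf_aRec n

/-- `d(bRecord' n) = 25n − 1`. -/
theorem dOf_bRecord' (n : ℕ) : dOf (bRecord' n) = 25 * n - 1 := by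
  obtain ⟨h0, h1, h2, h3, h4, h5, h6, h7⟩ := bRecord'_vals n
  simp only [dOf, sum_range_succ, sum_range_zero, zero_add, h0, h1, h2, h3, h4, h5, h6, h7]
  ring

/-! ### The pair floors `N_p` on the ray for `p > 16n` -/

/-- `z / p ≤ m` once `z < (m+1)·p` (`p > 0`). -/
theorem ediv_le_of_lt {z p : ℤ} (hp : 0 < p) (m : ℤ) (h : z < (m + 1) * p) : z / p ≤ m := by
  have := (Int.ediv_lt_iff_lt_mul hp).2 h
  omega

/-- The window exponent of THEOREM V on the ray: `[p ≤ 17n] + [p ≤ 18n]`. -/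
def pfBound (n p : ℕ) : ℤ := (if p ≤ 17 * n then 1 else 0) + (if p ≤ 18 * n then 1 else 0)

set_option maxHeartbeats 800000 in
/-- For `p > 16n`: `N_p(bRecord n) ≤ [p ≤ 17n] + [p ≤ 18n]` (all pair blocks `(b₀−b_i−b_k) = (7+i+k)n ≤ 18n` hold fewer than
two multiples of `p`, and only the blocks `17n, 18n` can hold one). -/
theorem pairFloors_bRecord_le {n p : ℕ} (hp : 16 * n + 1 ≤ p) : pairFloors (bRecord n) p ≤ pfBound n p := by
  obtain ⟨h0, h1, h2, h3, h4, h5, h6, h7⟩ := bRecord_vals n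
  have hp0 : (0 : ℤ) < p := by exact_mod_cast (show 0 < p by omega)
  simp only [pairFloors, sum_range_succ, sum_range_zero, zero_add, h0, h1, h2, h3, h4, h5, h6, h7]
  norm_num
  unfold pfBound
  have hpZ : (16 * n + 1 : ℤ) ≤ p := by exact_mod_cast hp
  -- each block term
  have t8 : ((41 : ℤ) * n - 17 * n - 16 * n) / p ≤ 0 := ediv_le_of_lt hp0 0 (by linarith)
  have t9 : ((41 : ℤ) * n - 17 * n - 15 * n) / p ≤ 0 := ediv_le_of_lt hp0 0 (by linarith)
  have t10a : ((41 : ℤ) * n - 17 * n - 14 * n) / p ≤ 0 := ediv_le_of_lt hp0 0 (by linarith)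
  have t11a : ((41 : ℤ) * n - 17 * n - 13 * n) / p ≤ 0 := ediv_le_of_lt hp0 0 (by linarith)
  have t12a : ((41 : ℤ) * n - 17 * n - 12 * n) / p ≤ 0 := ediv_le_of_lt hp0 0 (by linarith)
  have t13a : ((41 : ℤ) * n - 17 * n - 11 * n) / p ≤ 0 := ediv_le_of_lt hp0 0 (by linarith)
  have t10b : ((41 : ℤ) * n - 16 * n - 15 * n) / p ≤ 0 := ediv_le_of_lt hp0 0 (by linarith)
  have t11b : ((41 : ℤ) * n - 16 * n - 14 * n) / p ≤ 0 := ediv_le_of_lt hp0 0 (by linarith)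
  have t12b : ((41 : ℤ) * n - 16 * n - 13 * n) / p ≤ 0 := ediv_le_of_lt hp0 0 (by linarith)
  have t13b : ((41 : ℤ) * n - 16 * n - 12 * n) / p ≤ 0 := ediv_le_of_lt hp0 0 (by linarith)
  have t14a : ((41 : ℤ) * n - 16 * n - 11 * n) / p ≤ 0 := ediv_le_of_lt hp0 0 (by linarith)
  have t12c : ((41 : ℤ) * n - 15 * n - 14 * n) / p ≤ 0 := ediv_le_of_lt hp0 0 (by linarith)
  have t13c : ((41 : ℤ) * n - 15 * n - 13 * n) / p ≤ 0 := ediv_le_of_lt hp0 0 (by linarith)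
  have t14b : ((41 : ℤ) * n - 15 * n - 12 * n) / p ≤ 0 := ediv_le_of_lt hp0 0 (by linarith)
  have t15a : ((41 : ℤ) * n - 15 * n - 11 * n) / p ≤ 0 := ediv_le_of_lt hp0 0 (by linarith)
  have t14c : ((41 : ℤ) * n - 14 * n - 13 * n) / p ≤ 0 := ediv_le_of_lt hp0 0 (by linarith)
  have t15b : ((41 : ℤ) * n - 14 * n - 12 * n) / p ≤ 0 := ediv_le_of_lt hp0 0 (by linarith)
  have t16a : ((41 : ℤ) * n - 14 * n - 11 * n) / p ≤ 0 := ediv_le_of_lt hp0 0 (by linarith)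
  have t16b : ((41 : ℤ) * n - 13 * n - 12 * n) / p ≤ 0 := ediv_le_of_lt hp0 0 (by linarith)
  have t17 : ((41 : ℤ) * n - 13 * n - 11 * n) / p ≤ (if p ≤ 17 * n then 1 else 0 : ℤ) := by
    split_ifs with h
    · exact ediv_le_of_lt hp0 1 (by linarith)
    · have : (17 * n : ℤ) < p := by exact_mod_cast not_le.1 h
      exact ediv_le_of_lt hp0 0 (by linarith)
  have t18 : ((41 : ℤ) * n - 12 * n - 11 * n) / p ≤ (if p ≤ 18 * n then 1 else 0 : ℤ) := by
    split_ifs with h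
    · exact ediv_le_of_lt hp0 1 (by linarith)
    · have : (18 * n : ℤ) < p := by exact_mod_cast not_le.1 h
      exact ediv_le_of_lt hp0 0 (by linarith)
  linarith

set_option maxHeartbeats 800000 in
/-- For `p > 16n` (`n ≥ 1`): `N_p(bRecord' n) ≤ [p ≤ 17n] + [p ≤ 18n]`. -/
theorem pairFloors_bRecord'_le {n p : ℕ} (hn : 1 ≤ n) (hp : 16 * n + 1 ≤ p) : pairFloors (bRecord' n) p ≤ pfBound n p := by
  obtain ⟨h0, h1, h2, h3, h4, h5, h6, h7⟩ := bRecord'_vals n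
  have hp0 : (0 : ℤ) < p := by exact_mod_cast (show 0 < p by omega)
  have hnZ : (1 : ℤ) ≤ n := by exact_mod_cast hn
  simp only [pairFloors, sum_range_succ, sum_range_zero, zero_add, h0, h1, h2, h3, h4, h5, h6, h7]
  norm_num
  unfold pfBound
  have hpZ : (16 * n + 1 : ℤ) ≤ p := by exact_mod_cast hp
  have t8 : ((41 : ℤ) * n - 17 * n - 16 * n) / p ≤ 0 := ediv_le_of_lt hp0 0 (by linarith)
  have t9 : ((41 : ℤ) * n - 17 * n - 15 * n) / p ≤ 0 := ediv_le_of_lt hp0 0 (by linarith)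
  have t10a : ((41 : ℤ) * n - 17 * n - 14 * n) / p ≤ 0 := ediv_le_of_lt hp0 0 (by linarith)
  have t11a : ((41 : ℤ) * n - 17 * n - 13 * n) / p ≤ 0 := ediv_le_of_lt hp0 0 (by linarith)
  have t12a : ((41 : ℤ) * n - 17 * n - 12 * n) / p ≤ 0 := ediv_le_of_lt hp0 0 (by linarith)
  have t13a : ((41 : ℤ) * n - 17 * n - (11 * n + 1)) / p ≤ 0 := ediv_le_of_lt hp0 0 (by linarith)
  have t10b : ((41 : ℤ) * n - 16 * n - 15 * n) / p ≤ 0 := ediv_le_of_lt hp0 0 (by linarith)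
  have t11b : ((41 : ℤ) * n - 16 * n - 14 * n) / p ≤ 0 := ediv_le_of_lt hp0 0 (by linarith)
  have t12b : ((41 : ℤ) * n - 16 * n - 13 * n) / p ≤ 0 := ediv_le_of_lt hp0 0 (by linarith)
  have t13b : ((41 : ℤ) * n - 16 * n - 12 * n) / p ≤ 0 := ediv_le_of_lt hp0 0 (by linarith)
  have t14a : ((41 : ℤ) * n - 16 * n - (11 * n + 1)) / p ≤ 0 := ediv_le_of_lt hp0 0 (by linarith)
  have t12c : ((41 : ℤ) * n - 15 * n - 14 * n) / p ≤ 0 := ediv_le_of_lt hp0 0 (by linarith)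
  have t13c : ((41 : ℤ) * n - 15 * n - 13 * n) / p ≤ 0 := ediv_le_of_lt hp0 0 (by linarith)
  have t14b : ((41 : ℤ) * n - 15 * n - 12 * n) / p ≤ 0 := ediv_le_of_lt hp0 0 (by linarith)
  have t15a : ((41 : ℤ) * n - 15 * n - (11 * n + 1)) / p ≤ 0 := ediv_le_of_lt hp0 0 (by linarith)
  have t14c : ((41 : ℤ) * n - 14 * n - 13 * n) / p ≤ 0 := ediv_le_of_lt hp0 0 (by linarith)
  have t15b : ((41 : ℤ) * n - 14 * n - 12 * n) / p ≤ 0 := ediv_le_of_lt hp0 0 (by linarith)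
  have t16a : ((41 : ℤ) * n - 14 * n - (11 * n + 1)) / p ≤ 0 := ediv_le_of_lt hp0 0 (by linarith)
  have t16b : ((41 : ℤ) * n - 13 * n - 12 * n) / p ≤ 0 := ediv_le_of_lt hp0 0 (by linarith)
  have t17 : ((41 : ℤ) * n - 13 * n - (11 * n + 1)) / p ≤ (if p ≤ 17 * n then 1 else 0 : ℤ) := by
    split_ifs with h
    · exact ediv_le_of_lt hp0 1 (by linarith)
    · have : (17 * n : ℤ) < p := by exact_mod_cast not_le.1 h
      exact ediv_le_of_lt hp0 0 (by linarith)
  have t18 : ((41 : ℤ) * n - 12 * n - (11 * n + 1)) / p ≤ (if p ≤ 18 * n then 1 else 0 : ℤ) := by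
    split_ifs with h
    · exact ediv_le_of_lt hp0 1 (by linarith)
    · have : (18 * n : ℤ) < p := by exact_mod_cast not_le.1 h
      exact ediv_le_of_lt hp0 0 (by linarith)
  linarith

/-! ### Per-prime valuations for `16n < p ≤ 41n` -/

section Prime

variable {n p : ℕ}

/-- `41n + 2 < p²` for `p > 16n`, `p ≥ 17`. -/
theorem window_sq (hlo : 16 * n + 1 ≤ p) (hn : 1 ≤ n) : (41 * n : ℤ) + 2 < (p : ℤ) ^ 2 := by
  have h1 : (16 * n + 1 : ℤ) ≤ p := by exact_mod_cast hlo
  have h2 : (1 : ℤ) ≤ n := by exact_mod_cast hn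
  nlinarith

/-- `v_p(d_{41n}) = 1` for `16n < p ≤ 41n`. -/
theorem padicValRat_dRec (hn : 1 ≤ n) (hp : p.Prime) (hlo : 16 * n + 1 ≤ p) (hhi : p ≤ 41 * n) :
    padicValRat p (dRec n) = 1 := by
  haveI := Fact.mk hp
  unfold dRec
  rw [padicValRat.of_nat]
  have hsq : 41 * n < p ^ 2 := by
    have := window_sq hlo hn
    have h' : ((41 * n : ℕ) : ℤ) + 2 < ((p ^ 2 : ℕ) : ℤ) := by push_cast; exact this
    omega
  exact_mod_cast Literature.NumberTheory.Transcendental.Zudilin2004.padicValNat_lcmUpto_eq_one hhi hsq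

/-- `v_p(m!) = 0` for `m < p`. -/
theorem padicValRat_factorial_eq_zero (hp : p.Prime) {m : ℕ} (h : m < p) :
    padicValRat p ((m.factorial : ℕ) : ℚ) = 0 := by
  haveI := Fact.mk hp
  rw [padicValRat.of_nat]
  have : ¬ p ∣ m.factorial := fun hd => absurd (hp.dvd_factorial.1 hd) (not_le.2 h)
  exact_mod_cast padicValNat.eq_zero_of_not_dvd this

/-- `v_p(N♯(b)) ≥ 0` for `p > 16n` when `b₂ = 16n`, `b₃ = 15n` (the denominators `(16n)!(15n)!` are `p`-free). -/
theorem padicValRat_sharpNormaliser_nonneg (hp : p.Prime) (hlo : 16 * n + 1 ≤ p) {b : ℕ → ℤ}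
    (h2 : bn b 2 = 16 * n) (h3 : bn b 3 = 15 * n) : 0 ≤ padicValRat p (sharpNormaliser b) := by
  haveI := Fact.mk hp
  have hN : ((normaliser b : ℕ) : ℚ) ≠ 0 := by
    have : 0 < normaliser b := by unfold normaliser; exact prod_pos fun s _ => Nat.factorial_pos _
    exact_mod_cast this.ne'
  have hF : ∀ m : ℕ, ((m.factorial : ℕ) : ℚ) ≠ 0 := fun m => by exact_mod_cast (Nat.factorial_pos m).ne'
  unfold sharpNormaliser
  rw [h2, h3, padicValRat.div hN (mul_ne_zero (hF _) (hF _)), padicValRat.mul (hF _) (hF _),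
    padicValRat_factorial_eq_zero hp (by omega), padicValRat_factorial_eq_zero hp (by omega), padicValRat.of_nat]
  simp

/-- Slot facts of the ray for the big-prime theorems (slots `j₁ = 6`, `j₂ = 5`, `j₃ = 4`, i.e. `b₇, b₆, b₅`). -/
theorem slots_bRecord (n : ℕ) : bRecord n (5 + 1) ≤ bRecord n (4 + 1) ∧
    (∀ j ∈ range 7, j ≠ 6 → j ≠ 5 → bRecord n (4 + 1) ≤ bRecord n (j + 1)) := by
  obtain ⟨h0, h1, h2, h3, h4, h5, h6, h7⟩ := bRecord_vals n
  refine ⟨by rw [h6, h5]; omega, fun j hj hj6 hj5 => ?_⟩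
  have : j < 7 := mem_range.1 hj
  interval_cases j <;> simp_all <;> omega

/-- Slot facts of the partner. -/
theorem slots_bRecord' (n : ℕ) : bRecord' n (5 + 1) ≤ bRecord' n (4 + 1) ∧
    (∀ j ∈ range 7, j ≠ 6 → j ≠ 5 → bRecord' n (4 + 1) ≤ bRecord' n (j + 1)) := by
  obtain ⟨h0, h1, h2, h3, h4, h5, h6, h7⟩ := bRecord'_vals n
  refine ⟨by rw [h6, h5]; omega, fun j hj hj6 hj5 => ?_⟩
  have : j < 7 := mem_range.1 hj
  interval_cases j <;> simp_all <;> omega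

/-- **`W`, `U` are `p`-integral and `p ∣ W` below `25n`; `v_p(V) ≥ −N_p`** — on the ray `b = bRecord n`, `16n < p ≤ 41n`. -/
theorem coeff_bounds_bRecord (hn : 1 ≤ n) (hp : p.Prime) (hlo : 16 * n + 1 ≤ p) (hhi : p ≤ 41 * n) :
    (coeffW (bRecord n) ≠ 0 → (if p ≤ 25 * n then (1 : ℤ) else 0) ≤ padicValRat p (coeffW (bRecord n))) ∧
    (coeffU (bRecord n) ≠ 0 → 0 ≤ padicValRat p (coeffU (bRecord n))) ∧
    (coeffV (bRecord n) ≠ 0 → -pfBound n p ≤ padicValRat p (coeffV (bRecord n))) := by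
  haveI := Fact.mk hp
  have hP := inPolytope_bRecord n
  obtain ⟨hle, hmin⟩ := slots_bRecord n
  obtain ⟨h0, h1, h2, h3, h4, h5, h6, h7⟩ := bRecord_vals n
  have hpT : bRecord n 0 + 1 ≤ (p : ℤ) + bRecord n (5 + 1) + bRecord n (4 + 1) := by
    rw [h0, h6, h5]
    have : (16 * n + 1 : ℤ) ≤ p := by exact_mod_cast hlo
    linarith
  have hint := padicNorm_coeff_le_one_of_slots (bRecord n) 6 5 4 hP.1 hP.2.1 hP.2.2 (by simp) (by simp) (by simp)
    (by norm_num) hle hmin hpT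
  refine ⟨fun hW => ?_, fun hU => padicValRat_nonneg_of_padicNorm_le_one hU hint.2, fun hV => ?_⟩
  · split_ifs with h25
    · exact one_le_padicValRat_coeffW_of_slots (bRecord n) p 6 5 4 hP.1 hP.2.1 hP.2.2 (by simp) (by simp) (by simp)
        (by norm_num) hle hmin hp (by omega) hpT (by rw [dOf_bRecord]; have h' : (p : ℤ) ≤ 25 * n := (by exact_mod_cast h25); linarith) hW
    · exact padicValRat_nonneg_of_padicNorm_le_one hW hint.1
  · have hV' := constantTermFloorLaw_window (bRecord n) p hP hp (by omega) (by rw [h0]; exact window_sq hlo hn) hV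
    have := pairFloors_bRecord_le (n := n) hlo
    linarith

/-- The same on the partner `b′ = bRecord' n` (`p ∣ W(b′)` needs `p ≤ d(b′) + 1 = 25n`). -/
theorem coeff_bounds_bRecord' (hn : 1 ≤ n) (hp : p.Prime) (hlo : 16 * n + 1 ≤ p) (hhi : p ≤ 41 * n) :
    (coeffW (bRecord' n) ≠ 0 → (if p ≤ 25 * n then (1 : ℤ) else 0) ≤ padicValRat p (coeffW (bRecord' n))) ∧
    (coeffU (bRecord' n) ≠ 0 → 0 ≤ padicValRat p (coeffU (bRecord' n))) ∧
    (coeffV (bRecord' n) ≠ 0 → -pfBound n p ≤ padicValRat p (coeffV (bRecord' n))) := by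
  haveI := Fact.mk hp
  have hP := inPolytope_bRecord' hn
  obtain ⟨hle, hmin⟩ := slots_bRecord' n
  obtain ⟨h0, h1, h2, h3, h4, h5, h6, h7⟩ := bRecord'_vals n
  have hpT : bRecord' n 0 + 1 ≤ (p : ℤ) + bRecord' n (5 + 1) + bRecord' n (4 + 1) := by
    rw [h0, h6, h5]
    have : (16 * n + 1 : ℤ) ≤ p := by exact_mod_cast hlo
    linarith
  have hint := padicNorm_coeff_le_one_of_slots (bRecord' n) 6 5 4 hP.1 hP.2.1 hP.2.2 (by simp) (by simp) (by simp)
    (by norm_num) hle hmin hpT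
  refine ⟨fun hW => ?_, fun hU => padicValRat_nonneg_of_padicNorm_le_one hU hint.2, fun hV => ?_⟩
  · split_ifs with h25
    · exact one_le_padicValRat_coeffW_of_slots (bRecord' n) p 6 5 4 hP.1 hP.2.1 hP.2.2 (by simp) (by simp) (by simp)
        (by norm_num) hle hmin hp (by omega) hpT (by rw [dOf_bRecord']; have h' : (p : ℤ) ≤ 25 * n := (by exact_mod_cast h25); linarith) hW
    · exact padicValRat_nonneg_of_padicNorm_le_one hW hint.1
  · have hV' := constantTermFloorLaw_window (bRecord' n) p hP hp (by omega) (by rw [h0]; exact window_sq hlo hn) hV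
    have := pairFloors_bRecord'_le hn hlo
    linarith

end Prime

end Summit.KontsevichZagierPeriods.Zeta5Search.RecordRay
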